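import Summits.CriticalPhenomena.PercolationContinuityZ3.Theorems.PercNearOneGluingNoHeavyQuantDepthOneRows
import Summits.CriticalPhenomena.PercolationContinuityZ3.Theorems.PercNearOneGluingNoHeavyQuantSliceTwoRowRates
import HarnessLib

/-!
# QUANT lane R8, the node G₁ for a GENERAL partner, part 2: LAYER MONOTONICITY of the single-threshold (top-low-capacity) row and its
# NATURAL LAYER — for a nonnegative law every threshold `t` has ONE strongest row, at the last expensive mid `⌊t + (τ − 2t)/y⌋`

builds on p205010 (kernel theorem, internal audit signed; external expert review pending)

Support file (`--supports stmt-CriticalPhenomena-4575`), QUANT lane seat prim-quant-arm-2 (gen 40), rung R8 of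
`run/shared/lean/prim/quant/LADDER.md`; memo `run/shared/lean/prim/quant/prim-quant-arm-2-g40/G1-GENERAL-G40.md` §3.  Theorems only
(no definitions), standard axioms, no sorries.  Part 1: `…QuantTLCShiftedTarget` (shifted-target decomposition; the no-low-partner case of G₁).

THE FACT.  Fix a floor `0 < y < 1` (`u = y/(1−y)`), a target `τ`, a threshold `t` with `2t < τ`, and write the single-threshold row of layer `j`
in functional form `Σ_a C^{j,t}_τ(a)·ν(a) ≤ 0`, `C^{j,t}_τ(a) = u[a ≤ t] − [j+1 ≤ a] − u[a ≤ j ∧ τ < t+a]/usage y τ j t a` (the body of `LawDec.TLC`,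
census-2 g64).  Moving the layer only changes the coefficients of the atoms between the two layers: as a GIANT an atom is claimed at `1`, as a
MID at `u/usage(t,a)` if compatible (`τ < t + a`) and at `0` if not.  Hence (**`tlcCoef_le_of_layer_le_expensive`**) raising the layer across
atoms that are incompatible or EXPENSIVE (`usage ≥ u`) raises every coefficient, and (**`tlcCoef_ge_of_layer_le_cheap`**) raising it across CHEAP
compatible atoms (`usage ≤ u`) lowers every coefficient.  A compatible mid `a` of `t` is expensive iff `pairGate y τ t a ≥ y` iff `ρ = (τ−2t)/(a−t) ≥ y`
iff `y·(a − t) ≤ τ − 2t` (**`floor_le_usage_of_expensive`**, **`usage_le_floor_of_cheap`**; the strict branch `y² + (1−y)ρ` of the minimal gate is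
always cheap), so the expensive mids are an initial segment and the row at the NATURAL LAYER `j*_t` = the last expensive compatible mid (any `j*` with
"every compatible mid `≤ j*` expensive, every atom above `j*` a cheap compatible mid") has the pointwise LARGEST coefficient vector: for a
nonnegative `ν` it implies the threshold-`t` row at EVERY layer (**`tlcRow_functional_of_naturalLayer`**).  So the depth-≤1 family `LawDec.TLC` of a
nonnegative law is, threshold by threshold, ONE row; and the pure-`TLC` certificates of the node G₁ (memo §3–§4: 7 676 of the 7 737 non-tilt product rows
in kit j228161) are canonically `Σ_t W_t · row(j*_t, t)` with the effective-staircase weights `W_t` — no linear programme is needed to decide them.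
EXACT CHECK of the natural-layer statement behind the Lean proof: 6 187 random `(y, τ, M, t, j′)` / 0 exceptions (`code/` of the memo).
HONEST STATUS: G₁ (`TLC2GateConvTLC`), SGC and `Quant.FarTreeRow` (light) remain OPEN; nothing here is cited as a published result; the lane's RATE
class log\* and honest sentence (`run/shared/lean/prim/quant/README.md`) are unchanged.

[this work]; `pairGate`, `usage`, `usage_pos_of_compat`, `pairGate_lt_one`: prim-quant-stmt g22; `TLC`: prim-quant-census-2 g64 (this lane).  The gluing rows
served [cite: KozmaNitzan2024, Conjecture 3 (p. 15)]; product measure [cite: Grimmett1999, §1.3 p. 10].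
-/

noncomputable section

namespace Summit.CriticalPhenomena.PercolationContinuityZ3.Theorems

namespace Quant

open Finset

namespace LawDec

/-! ### Expensive and cheap mids in closed form -/

/-- the mid form of `usage` below the layer. -/
private theorem usage_mid (y τ : ℝ) (j t a : ℕ) (ha : a ≤ j) :
    usage y τ j t a = pairGate y τ t a / (1 - pairGate y τ t a) := by
  have hnj : ¬ (j + 1 ≤ a) := by omega
  simp only [usage, gateOf, if_neg hnj]

/-- **an EXPENSIVE compatible mid**: `t < a ≤ j`, `τ < t + a`, `y·(a − t) ≤ τ − 2t` (i.e. `ρ ≥ y`) ⟹ `y/(1−y) ≤ usage y τ j t a`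
(`0 < y < 1`). [this work] -/
theorem floor_le_usage_of_expensive (y τ : ℝ) (j t a : ℕ) (hy0 : 0 < y) (hy1 : y < 1) (hta : t < a) (haj : a ≤ j)
    (hcomp : τ < (t : ℝ) + a) (hexp : y * ((a : ℝ) - t) ≤ τ - 2 * (t : ℝ)) : y / (1 - y) ≤ usage y τ j t a := by
  have hlow : 2 * (t : ℝ) < τ := by
    have : (t : ℝ) < a := by exact_mod_cast hta
    nlinarith
  have hd : 0 < (a : ℝ) - t := by
    have : (t : ℝ) < a := by exact_mod_cast hta
    linarith
  have hρ : y ≤ (τ - 2 * (t : ℝ)) / ((a : ℝ) - t) := by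
    rw [le_div_iff₀ hd]; linarith
  have hG : y ≤ pairGate y τ t a := le_trans hρ (le_max_left _ _)
  have hG1 : pairGate y τ t a < 1 := pairGate_lt_one y τ t a hy0 hy1 hlow hcomp
  rw [usage_mid y τ j t a haj, div_le_div_iff₀ (by linarith) (by linarith)]
  nlinarith

/-- **a CHEAP compatible mid**: `t < a ≤ j`, `τ − 2t ≤ y·(a − t)` (i.e. `ρ ≤ y`) ⟹ `usage y τ j t a ≤ y/(1−y)` (`0 < y < 1`; both branches of the
minimal gate are then `≤ y`). [this work] -/
theorem usage_le_floor_of_cheap (y τ : ℝ) (j t a : ℕ) (hy1 : y < 1) (hta : t < a) (haj : a ≤ j)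
    (hch : τ - 2 * (t : ℝ) ≤ y * ((a : ℝ) - t)) : usage y τ j t a ≤ y / (1 - y) := by
  have hd : 0 < (a : ℝ) - t := by
    have : (t : ℝ) < a := by exact_mod_cast hta
    linarith
  have hρ : (τ - 2 * (t : ℝ)) / ((a : ℝ) - t) ≤ y := by
    rw [div_le_iff₀ hd]; linarith
  have hG : pairGate y τ t a ≤ y := by
    unfold pairGate
    refine max_le hρ ?_
    nlinarith
  rw [usage_mid y τ j t a haj, div_le_div_iff₀ (by linarith) (by linarith)]
  nlinarith

/-! ### Layer monotonicity of the row coefficient -/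

/-- **raising the layer across incompatible-or-expensive atoms RAISES the coefficients**: `j′ ≤ j″`, and every atom `j′ < a ≤ j″` that is
compatible with `t` (`τ < t + a`) is expensive (`y/(1−y) ≤ usage`); then `C^{j′,t}_τ(a) ≤ C^{j″,t}_τ(a)` for every `a` (`0 < y < 1`). [this work] -/
theorem tlcCoef_le_of_layer_le_expensive (y τ : ℝ) (t j' j'' a : ℕ) (hy0 : 0 < y) (hy1 : y < 1) (hjj : j' ≤ j'')
    (hexp : j' < a → a ≤ j'' → τ < (t : ℝ) + a → y / (1 - y) ≤ usage y τ j'' t a) :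
    y / (1 - y) * (if a ≤ t then (1 : ℝ) else 0) - (if j' + 1 ≤ a then (1 : ℝ) else 0)
        - y / (1 - y) * (if a ≤ j' ∧ τ < (t : ℝ) + a then 1 / usage y τ j' t a else 0)
      ≤ y / (1 - y) * (if a ≤ t then (1 : ℝ) else 0) - (if j'' + 1 ≤ a then (1 : ℝ) else 0)
        - y / (1 - y) * (if a ≤ j'' ∧ τ < (t : ℝ) + a then 1 / usage y τ j'' t a else 0) := by
  have h1y : 0 < 1 - y := by linarith
  have hu0 : 0 < y / (1 - y) := div_pos hy0 h1y
  rcases Nat.lt_or_ge j' a with hja | hja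
  · -- `a > j′`: a giant of the lower layer
    have g1 : (if j' + 1 ≤ a then (1 : ℝ) else 0) = 1 := if_pos (by omega)
    have m1 : (if a ≤ j' ∧ τ < (t : ℝ) + a then 1 / usage y τ j' t a else 0) = 0 :=
      if_neg (fun h => absurd h.1 (by omega))
    rw [g1, m1]
    rcases Nat.lt_or_ge j'' a with hja2 | hja2
    · have g2 : (if j'' + 1 ≤ a then (1 : ℝ) else 0) = 1 := if_pos (by omega)
      have m2 : (if a ≤ j'' ∧ τ < (t : ℝ) + a then 1 / usage y τ j'' t a else 0) = 0 :=
        if_neg (fun h => absurd h.1 (by omega))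
      rw [g2, m2]
    · have g2 : (if j'' + 1 ≤ a then (1 : ℝ) else 0) = 0 := if_neg (by omega)
      rw [g2]
      by_cases hc : τ < (t : ℝ) + a
      · have m2 : (if a ≤ j'' ∧ τ < (t : ℝ) + a then 1 / usage y τ j'' t a else 0) = 1 / usage y τ j'' t a :=
          if_pos ⟨hja2, hc⟩
        rw [m2]
        have hge := hexp hja hja2 hc
        have hpos : 0 < usage y τ j'' t a := lt_of_lt_of_le hu0 hge
        have : y / (1 - y) * (1 / usage y τ j'' t a) ≤ 1 := by
          rw [← div_eq_mul_one_div, div_le_one hpos]; exact hge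
        linarith
      · have m2 : (if a ≤ j'' ∧ τ < (t : ℝ) + a then 1 / usage y τ j'' t a else 0) = 0 := if_neg (fun h => hc h.2)
        rw [m2]
        linarith
  · -- `a ≤ j′ ≤ j″`: the same mid for both layers
    have g1 : (if j' + 1 ≤ a then (1 : ℝ) else 0) = 0 := if_neg (by omega)
    have g2 : (if j'' + 1 ≤ a then (1 : ℝ) else 0) = 0 := if_neg (by omega)
    rw [g1, g2]
    have hus : usage y τ j' t a = usage y τ j'' t a := by
      rw [usage_mid y τ j' t a hja, usage_mid y τ j'' t a (le_trans hja hjj)]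
    by_cases hc : τ < (t : ℝ) + a
    · have m1 : (if a ≤ j' ∧ τ < (t : ℝ) + a then 1 / usage y τ j' t a else 0) = 1 / usage y τ j' t a := if_pos ⟨hja, hc⟩
      have m2 : (if a ≤ j'' ∧ τ < (t : ℝ) + a then 1 / usage y τ j'' t a else 0) = 1 / usage y τ j'' t a :=
        if_pos ⟨le_trans hja hjj, hc⟩
      rw [m1, m2, hus]
    · have m1 : (if a ≤ j' ∧ τ < (t : ℝ) + a then 1 / usage y τ j' t a else 0) = 0 := if_neg (fun h => hc h.2)
      have m2 : (if a ≤ j'' ∧ τ < (t : ℝ) + a then 1 / usage y τ j'' t a else 0) = 0 := if_neg (fun h => hc h.2)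
      rw [m1, m2]

/-- **raising the layer across cheap compatible atoms LOWERS the coefficients**: `j′ ≤ j″`, and every atom `j′ < a ≤ j″` is a compatible
(`τ < t + a`) cheap (`usage ≤ y/(1−y)`) mid of `t`; then `C^{j″,t}_τ(a) ≤ C^{j′,t}_τ(a)` for every `a` (`0 < y < 1`, `2t < τ`, `t ≤ j′`). [this work] -/
theorem tlcCoef_ge_of_layer_le_cheap (y τ : ℝ) (t j' j'' a : ℕ) (hy0 : 0 < y) (hy1 : y < 1) (hlow : 2 * (t : ℝ) < τ) (htj : t ≤ j')
    (hjj : j' ≤ j'') (hch : j' < a → a ≤ j'' → τ < (t : ℝ) + a ∧ usage y τ j'' t a ≤ y / (1 - y)) :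
    y / (1 - y) * (if a ≤ t then (1 : ℝ) else 0) - (if j'' + 1 ≤ a then (1 : ℝ) else 0)
        - y / (1 - y) * (if a ≤ j'' ∧ τ < (t : ℝ) + a then 1 / usage y τ j'' t a else 0)
      ≤ y / (1 - y) * (if a ≤ t then (1 : ℝ) else 0) - (if j' + 1 ≤ a then (1 : ℝ) else 0)
        - y / (1 - y) * (if a ≤ j' ∧ τ < (t : ℝ) + a then 1 / usage y τ j' t a else 0) := by
  have h1y : 0 < 1 - y := by linarith
  have hu0 : 0 < y / (1 - y) := div_pos hy0 h1y
  rcases Nat.lt_or_ge j' a with hja | hja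
  · have g1 : (if j' + 1 ≤ a then (1 : ℝ) else 0) = 1 := if_pos (by omega)
    have m1 : (if a ≤ j' ∧ τ < (t : ℝ) + a then 1 / usage y τ j' t a else 0) = 0 :=
      if_neg (fun h => absurd h.1 (by omega))
    rw [g1, m1]
    rcases Nat.lt_or_ge j'' a with hja2 | hja2
    · have g2 : (if j'' + 1 ≤ a then (1 : ℝ) else 0) = 1 := if_pos (by omega)
      have m2 : (if a ≤ j'' ∧ τ < (t : ℝ) + a then 1 / usage y τ j'' t a else 0) = 0 :=
        if_neg (fun h => absurd h.1 (by omega))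
      rw [g2, m2]
    · have g2 : (if j'' + 1 ≤ a then (1 : ℝ) else 0) = 0 := if_neg (by omega)
      obtain ⟨hc, hle⟩ := hch hja hja2
      have m2 : (if a ≤ j'' ∧ τ < (t : ℝ) + a then 1 / usage y τ j'' t a else 0) = 1 / usage y τ j'' t a :=
        if_pos ⟨hja2, hc⟩
      rw [g2, m2]
      have hta : t < a := by omega
      have hpos : 0 < usage y τ j'' t a := usage_pos_of_compat y τ j'' t a hy0 hy1 hlow hta (Or.inr hc)
      have : 1 ≤ y / (1 - y) * (1 / usage y τ j'' t a) := by
        rw [← div_eq_mul_one_div, one_le_div hpos]; exact hle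
      linarith
  · have g1 : (if j' + 1 ≤ a then (1 : ℝ) else 0) = 0 := if_neg (by omega)
    have g2 : (if j'' + 1 ≤ a then (1 : ℝ) else 0) = 0 := if_neg (by omega)
    rw [g1, g2]
    have hus : usage y τ j' t a = usage y τ j'' t a := by
      rw [usage_mid y τ j' t a hja, usage_mid y τ j'' t a (le_trans hja hjj)]
    by_cases hc : τ < (t : ℝ) + a
    · have m1 : (if a ≤ j' ∧ τ < (t : ℝ) + a then 1 / usage y τ j' t a else 0) = 1 / usage y τ j' t a := if_pos ⟨hja, hc⟩
      have m2 : (if a ≤ j'' ∧ τ < (t : ℝ) + a then 1 / usage y τ j'' t a else 0) = 1 / usage y τ j'' t a :=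
        if_pos ⟨le_trans hja hjj, hc⟩
      rw [m1, m2, hus]
    · have m1 : (if a ≤ j' ∧ τ < (t : ℝ) + a then 1 / usage y τ j' t a else 0) = 0 := if_neg (fun h => hc h.2)
      have m2 : (if a ≤ j'' ∧ τ < (t : ℝ) + a then 1 / usage y τ j'' t a else 0) = 0 := if_neg (fun h => hc h.2)
      rw [m1, m2]

/-! ### The natural layer: one strongest row per threshold -/

/-- **THE NATURAL-LAYER ROW IMPLIES THE THRESHOLD-`t` ROW AT EVERY LAYER** (nonnegative `ν` on `{0..N}`, `0 < y < 1`, `2t < τ`).  Let `t ≤ j*`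
be a layer such that every compatible mid `a ≤ j*` of `t` is expensive (`y·(a−t) ≤ τ − 2t`) and every atom `j* < a ≤ N` is a cheap compatible mid
(`τ < t + a`, `τ − 2t ≤ y·(a−t)`) — e.g. `j* = ⌊t + (τ−2t)/y⌋`, the last expensive mid.  If `ν` satisfies the row `(j*, t)` in functional form then
it satisfies the row `(j, t)` for every layer `j` (for `j < t` the functional row is only formal): the natural-layer coefficients dominate pointwise (`tlcCoef_le_of_layer_le_expensive` below `j*`,
`tlcCoef_ge_of_layer_le_cheap` above). [this work] -/
theorem tlcRow_functional_of_naturalLayer (y τ : ℝ) (N t js j : ℕ) (ν : ℕ → ℝ) (hy0 : 0 < y) (hy1 : y < 1)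
    (hν : ∀ a, 0 ≤ ν a) (hlow : 2 * (t : ℝ) < τ) (htjs : t ≤ js)
    (hexp : ∀ a : ℕ, t < a → a ≤ js → τ < (t : ℝ) + a → y * ((a : ℝ) - t) ≤ τ - 2 * (t : ℝ))
    (hcheap : ∀ a : ℕ, js < a → a ≤ N → τ < (t : ℝ) + a ∧ τ - 2 * (t : ℝ) ≤ y * ((a : ℝ) - t))
    (hrow : ∑ a ∈ Finset.range (N + 1), (y / (1 - y) * (if a ≤ t then (1 : ℝ) else 0) - (if js + 1 ≤ a then (1 : ℝ) else 0)
      - y / (1 - y) * (if a ≤ js ∧ τ < (t : ℝ) + a then 1 / usage y τ js t a else 0)) * ν a ≤ 0) :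
    ∑ a ∈ Finset.range (N + 1), (y / (1 - y) * (if a ≤ t then (1 : ℝ) else 0) - (if j + 1 ≤ a then (1 : ℝ) else 0)
      - y / (1 - y) * (if a ≤ j ∧ τ < (t : ℝ) + a then 1 / usage y τ j t a else 0)) * ν a ≤ 0 := by
  refine le_trans (Finset.sum_le_sum fun a ha => mul_le_mul_of_nonneg_right ?_ (hν a)) hrow
  rw [Finset.mem_range] at ha
  rcases Nat.lt_or_ge js j with hjlt | hjle
  · -- `j* < j`: lower the layer across cheap compatible atoms
    refine tlcCoef_ge_of_layer_le_cheap y τ t js j a hy0 hy1 hlow htjs hjlt.le fun hja haj => ?_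
    obtain ⟨hc, hch⟩ := hcheap a hja (by omega)
    exact ⟨hc, usage_le_floor_of_cheap y τ j t a hy1 (by omega) haj hch⟩
  · -- `j ≤ j*`: raise the layer across expensive-or-incompatible atoms
    refine tlcCoef_le_of_layer_le_expensive y τ t j js a hy0 hy1 hjle fun _ hajs hc => ?_
    have hta : t < a := by
      have : (t : ℝ) < a := by linarith
      exact_mod_cast this
    exact floor_le_usage_of_expensive y τ js t a hy0 hy1 hta hajs hc (hexp a hta hajs hc)

end LawDec

end Quant

end Summit.CriticalPhenomena.PercolationContinuityZ3.Theorems
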